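import Mathlib.Analysis.InnerProductSpace.PiL2
import Mathlib.Analysis.Calculus.ContDiff.Defs
import Mathlib.Analysis.Calculus.IteratedDeriv.Defs
import Mathlib.Analysis.Calculus.IteratedDeriv.Lemmas
import Mathlib.Analysis.Fourier.FourierTransform
import Mathlib.MeasureTheory.Measure.Haar.InnerProductSpace
import Mathlib.MeasureTheory.Integral.IntervalIntegral.Basic
import Mathlib.Analysis.SpecialFunctions.Trigonometric.Basic
import HarnessLib

/-!
# Feldman–Knörrer–Trubowitz, *A two dimensional Fermi liquid. Part 1: Overview* (CMP 247 (2004)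
1–47): the hypotheses on the dispersion relation, strong asymmetry, and the shape of Theorems I–III

Topic `Literature/MathematicalPhysics/QuantumLattice/FermiRG`; statements-first typing (D-0069 (2)
typer wave, seat t3, DAG file F7d) of

* J. Feldman, H. Knörrer, E. Trubowitz, *A two dimensional Fermi liquid. Part 1: Overview*,
  Comm. Math. Phys. 247 (2004) 1–47, arXiv:math-ph/0209047 [FeldmanKnorrerTrubowitz2004]. Locators
  `p.N (Ln)` = N-th 3000-character chunk (line n) of the materialised arXiv TeX
  (`lit read arxiv:math-ph/0209047`); the paper's statements are labelled symbolically in the TeX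
  (`\hypNPdisprel`, `\defNPstrongasymm`, `\theoremNPmainthI`–`III`); printed numbering: Hypothesis on
  the dispersion relation, Definition (strong asymmetry), Theorems I.4/I.5/I.7 in CMP = "Theorems
  I, II, III" below.

## What is here

1. **The setting of §I for `d = 2`** (p.3 L60 – p.4 L60): momentum space `ℝ²`, a dispersion relation
   `e(k⃗)` ALREADY SHIFTED by the chemical potential, its Fermi curve `F = {e = 0}`, an ultraviolet
   cutoff `U(k⃗)` (`IsUVCutoff`), the counterterm space `ℰ` (Definition, p.4 L1–10: `IsCounterterm`),
   space–time–spin points `(x₀, x⃗, σ)`, four-legged interaction kernels `V` with translation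
   invariance and the two symmetries (k₀-reversal reality (eqnNPreal), bar/unbar exchange
   (eqnNPphexchange), p.4 L44–54).
2. **The hypotheses on the dispersion relation** (`\hypNPdisprel`, p.7 L80–88 and p.8 L1–5) as a
   `Prop`-valued PREDICATE `FKT2004.Hypotheses r D` on Fermi-curve DATA `D` (the dispersion `e`, the
   Gauss-map parametrisation `γ` of `F` by the angle of the outward normal, and the local graphs
   `φ_k⃗(s)` of Definition i), p.7 L90–97) — never asserted, and in particular NEVER instantiated at
   the Hubbard `squareDispersion`: the square-lattice Fermi curve is symmetric about a point, hence
   NOT strongly asymmetric (Remark ii), p.7 L111–115: «Symmetry of the Fermi curve about a point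
   promotes the formation of Cooper pairs … Theorem I shows that — at temperature zero — this is the
   only instability»), which is exactly why the Hubbard programme (rung R2d) is a Kohn–Luttinger
   statement and not a `T = 0` Fermi liquid.
3. **Strong asymmetry** (Definition ii), p.7 L98–104): `FKT2004.StronglyAsymmetric r φ`; and
   Remark ii) (p.7 L111–115) PROVED: a Fermi curve symmetric about a point (`γ(α+π) = 2p - γ(α)`) has
   `φ_k⃗ = φ_{a(k⃗)}` near `0`, hence is not strongly asymmetric
   (`not_stronglyAsymmetric_of_pointSymmetric`).
4. **Theorems I, II, III** (p.6 L53–84, p.6 L89–115, p.7 L1–42). Their CONCLUSIONS are typed as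
   predicates on Green's-function data: `TheoremIConclusion` (existence of an analytic counterterm
   map `V ↦ δe(V) ∈ ℰ` with `δe(0) = 0` and convergence / `𝔦 → ∞` limit / analyticity of the
   renormalized Green's functions — analyticity rendered along complex lines `z ↦ G(zV)`, a
   consequence of the printed Banach-space analyticity), `TheoremIIConclusion` (continuity of `Ǧ₂`
   off `{k₀ = 0, e = 0}`, the momentum distribution `n(k⃗)` continuous off `F` with one-sided limits
   across `F` whose JUMP EXCEEDS `½` — `½` is not sharp: «may be replaced by any number strictly
   smaller than one, provided the interaction is made sufficiently weak», Remark p.6 L118–124),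
   `TheoremIIIConclusion` (continuity of the amputated `Ǧ₄^A` on `{k₁ ≠ k₂, k₂ ≠ k₃, U = 1}` and the
   decomposition `N + ½L(·,·,k₂-k₁) - ½L(·,·,k₂-k₃)` with `N` continuous, `L(q₁,q₂,t)` continuous
   except at transfer `t = 0`, and the TWO one-sided continuous extensions of `L` to `t = (0, τ⃗ → 0)`
   and to `t = (t₀ → 0, 0⃗)` — typed as two extensions, not as "`L` discontinuous"; `L` = the
   particle–hole ladders, Remark p.7 L44–49).
   **GAP (cell GAP-LEDGER row G-t3-02).** The OBJECTS of these theorems — the scale-`𝔦` renormalized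
   connected Green's functions `G_{2n;𝔦}(V)` defined through the renormalized perturbation expansion
   of `log Z⁻¹ ∫ e^{φJψ} e^{λ𝒱} dμ_{C^{IR(𝔦)}(δe(V))}` (p.5 L1 – p.6 L52), their limits `G_{2n}`, and
   the Fourier transforms `Ǧ₂`, `Ǧ₄` — are continuum, zero-temperature, infinite-volume Grassmann
   Gaussian perturbation series for which the tree has no vocabulary (its Grassmann calculus is
   finite-dimensional). They enter the conclusion predicates as explicit DATA binders
   (`RenormalizedGreenData`, `MomentumGreenData`); the named-fact form
   `Hypotheses → TheoremIConclusion (the FKT expansion of (e, U, V))` is therefore NOT declared in this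
   wave (no fact is minted on an undefined object). Remark `\remNPmainthI` (p.7 L54–76):
   finite-volume versions and renormalization-prescription independence (the inversion
   `e - δe(V) = e' - δe'(V)`) are NOT addressed by the paper — the same open inversion as BGM 2003's
   `ε₀ = ε + ν̂` and FST's `E = e + K`; nothing of it is typed.

## Conventions

* `d = 2` throughout (the theorems assume it); momenta and positions are `EuclideanSpace ℝ (Fin 2)`.
* The Fermi curve is parametrised by the angle `α` of the OUTWARD unit normal
  `ν(α) = (cos α, sin α)` (legitimate data: `F` is strictly convex with curvature bounded away from
  zero, so the Gauss map is a diffeomorphism); the oriented unit tangent is `t(α) = (-sin α, cos α)`,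
  the inward normal is `-ν(α)`, and the ANTIPODE of `γ(α)` (the other point with a parallel tangent
  line, p.7 L84–87) is `γ(α + π)`.
* `<k, x>_- = -k₀x₀ + k⃗·x⃗` (p.4 L27).
* No `instance`, no notation; kernels are plain functions; the Banach-space norm of Theorem I is the
  `ℝ≥0∞`-valued `kernelNorm r r₀` (no junk values).
-/

noncomputable section

open Real Set Filter MeasureTheory Complex
open scoped Topology ENNReal FourierTransform

namespace Literature.MathematicalPhysics.QuantumLattice.FermiRG

namespace FKT2004

/-! ### §I: momenta, space–time–spin points, cutoffs, counterterms, kernels -/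

/-- Momentum / position space `ℝ²` (`d = 2`). [cite: FeldmanKnorrerTrubowitz2004, §I p.3 (L60–70)] -/
abbrev R2 : Type := EuclideanSpace ℝ (Fin 2)

/-- Space–time `ℝ × ℝ²`: `(x₀, x⃗)` with `x₀` the Euclidean time (or `(k₀, k⃗)`). [cite: FeldmanKnorrerTrubowitz2004, §I p.4 (L12–16)] -/
abbrev SpaceTime : Type := ℝ × R2

/-- Space–time–spin points `x = (x₀, x⃗, σ)`, `σ ∈ {↑, ↓} = Fin 2`. [cite: FeldmanKnorrerTrubowitz2004, §I p.4 (L12–16)] -/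
abbrev SpaceTimeSpin : Type := SpaceTime × Fin 2

/-- A four-legged interaction kernel `V(x₁, x₂, x₃, x₄)` of
`𝒱 = ∫ V(x₁,x₂,x₃,x₄) ψ̄(x₁)ψ(x₂)ψ̄(x₃)ψ(x₄)`. [cite: FeldmanKnorrerTrubowitz2004, §I p.4 (L37–43)] -/
abbrev Kernel : Type := (Fin 4 → SpaceTimeSpin) → ℂ

/-- The Fermi curve `F = {k⃗ ∈ ℝ² : e(k⃗) = 0}` of a dispersion relation already shifted by the
chemical potential. [cite: FeldmanKnorrerTrubowitz2004, §I p.3 (L66–70)] -/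
def fermiCurve (e : R2 → ℝ) : Set R2 := {k | e k = 0}

/-- **Ultraviolet cutoff**: `U` smooth, compactly supported, `0 ≤ U ≤ 1`, identically one on a
neighbourhood of the Fermi curve (so `F` is compact). [cite: FeldmanKnorrerTrubowitz2004, §I p.3 (L71–75) and footnote (1)] -/
structure IsUVCutoff (e : R2 → ℝ) (U : R2 → ℝ) : Prop where
  smooth : ContDiff ℝ ((⊤ : ℕ∞) : WithTop ℕ∞) U
  compact : HasCompactSupport U
  range : ∀ k, 0 ≤ U k ∧ U k ≤ 1
  one_near : ∃ O : Set R2, IsOpen O ∧ fermiCurve e ⊆ O ∧ ∀ k ∈ O, U k = 1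

/-- **The space of counterterms `ℰ`** (Definition, p.4 L1–10): functions `δe(k⃗)` supported in
`{U = 1}` whose Fourier transform `δe^∧(x⃗) = ∫ d²k/(2π)² e^{-ik⃗·x⃗} δe(k⃗)` is in `L¹` (Mathlib's `𝓕`
differs by the harmless `2π`-rescaling). Complex-valued: Theorem I's `δe(V)` is real only for
`k₀`-reversal-real `V`. [cite: FeldmanKnorrerTrubowitz2004, §I Definition (space of counterterms) p.4 (L1–10)] -/
structure IsCounterterm (U : R2 → ℝ) (δe : R2 → ℂ) : Prop where
  support : ∀ k, δe k ≠ 0 → U k = 1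
  integrable : Integrable δe
  fourier_integrable : Integrable (𝓕 δe)

/-- The bilinear pairing `<k, x>_- = -k₀x₀ + k⃗·x⃗` (p.4 L27). [cite: FeldmanKnorrerTrubowitz2004, §I p.4 (L22–28)] -/
def pairMinus (k x : SpaceTime) : ℝ := -(k.1 * x.1) + inner ℝ k.2 x.2

/-- Translation of a space–time–spin point by `a ∈ ℝ × ℝ²` (spin untouched). [cite: FeldmanKnorrerTrubowitz2004, §I p.4 (L43)] -/
def translate (a : SpaceTime) (x : SpaceTimeSpin) : SpaceTimeSpin := ((x.1.1 + a.1, x.1.2 + a.2), x.2)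

/-- `V` is translation invariant: `V(x₁+a, …, x₄+a) = V(x₁, …, x₄)`. [cite: FeldmanKnorrerTrubowitz2004, §I p.4 (L43)] -/
def IsTranslationInvariant (V : Kernel) : Prop :=
  ∀ (a : SpaceTime) (x : Fin 4 → SpaceTimeSpin), V (fun i => translate a (x i)) = V x

/-- `V` is spin independent in the density–density sense of (eqnNPinteraction):
`V((·,σ₁),(·,σ₂),(·,σ₃),(·,σ₄)) = δ_{σ₁σ₂} δ_{σ₃σ₄} W(positions)` (a conservative reading of "spin
independent"; the general notion is in [FKTo2] App. Symmetries). [cite: FeldmanKnorrerTrubowitz2004, §I (eqnNPinteraction) p.4 (L55–63)] -/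
def IsSpinIndependent (V : Kernel) : Prop :=
  ∃ W : (Fin 4 → SpaceTime) → ℂ, ∀ x : Fin 4 → SpaceTimeSpin,
    V x = if (x 0).2 = (x 1).2 ∧ (x 2).2 = (x 3).2 then W (fun i => (x i).1) else 0

/-- `R₀(x₀, x⃗, σ) = (-x₀, x⃗, σ)`. [cite: FeldmanKnorrerTrubowitz2004, §I p.4 (L49)] -/
def timeReversal (x : SpaceTimeSpin) : SpaceTimeSpin := ((-x.1.1, x.1.2), x.2)

/-- `-(x₀, x⃗, σ) = (-x₀, -x⃗, σ)`. [cite: FeldmanKnorrerTrubowitz2004, §I p.4 (L49)] -/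
def negPoint (x : SpaceTimeSpin) : SpaceTimeSpin := ((-x.1.1, -x.1.2), x.2)

/-- **`k₀`-reversal reality** (eqnNPreal): `V(R₀x₁, R₀x₂, R₀x₃, R₀x₄) = conj V(-x₁, -x₂, -x₃, -x₄)`. [cite: FeldmanKnorrerTrubowitz2004, §I (eqnNPreal) p.4 (L44–47)] -/
def IsK0ReversalReal (V : Kernel) : Prop :=
  ∀ x : Fin 4 → SpaceTimeSpin,
    V (fun i => timeReversal (x i)) = starRingEnd ℂ (V (fun i => negPoint (x i)))

/-- **Bar/unbar exchange invariance** (eqnNPphexchange): `V(-x₂, -x₁, -x₄, -x₃) = V(x₁, x₂, x₃, x₄)`. [cite: FeldmanKnorrerTrubowitz2004, §I (eqnNPphexchange) p.4 (L48–50)] -/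
def IsBarUnbarExchangeInvariant (V : Kernel) : Prop :=
  ∀ x : Fin 4 → SpaceTimeSpin, V ![negPoint (x 1), negPoint (x 0), negPoint (x 3), negPoint (x 2)] = V x

/-- A multi-index `δ = (δ₀, δ⃗) ∈ ℕ₀ × ℕ₀²` (temporal order `δ₀`, spatial part `δ⃗`). [cite: FeldmanKnorrerTrubowitz2004, §I p.4 (L75–84)] -/
abbrev MultiIndex : Type := ℕ × (Fin 2 → ℕ)

/-- `|δ⃗| = δ₁ + δ₂`, the length of the spatial part. [cite: FeldmanKnorrerTrubowitz2004, §I p.4 (L80–84)] -/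
def MultiIndex.spatialLength (δ : MultiIndex) : ℕ := δ.2 0 + δ.2 1

/-- `δ! = δ₀! δ₁! δ₂!`. [cite: FeldmanKnorrerTrubowitz2004, §I p.4 (L78)] -/
def MultiIndex.factorial (δ : MultiIndex) : ℕ := δ.1.factorial * (δ.2 0).factorial * (δ.2 1).factorial

/-- `(x - x')^δ = (x₀ - x₀')^{δ₀} (x⃗₁ - x⃗'₁)^{δ₁} (x⃗₂ - x⃗'₂)^{δ₂}`. [cite: FeldmanKnorrerTrubowitz2004, §I p.4 (L85–89)] -/
def monomial (δ : MultiIndex) (x x' : SpaceTimeSpin) : ℝ :=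
  (x.1.1 - x'.1.1) ^ δ.1 * (x.1.2 0 - x'.1.2 0) ^ δ.2 0 * (x.1.2 1 - x'.1.2 1) ^ δ.2 1

/-- The ordered pairs `1 ≤ i < j ≤ 4` of legs. [folklore] -/
abbrev LegPair : Type := {p : Fin 4 × Fin 4 // p.1 < p.2}

/-- **The `L₁–L_∞` norm** `⫼f⫼_{1,∞} = max_{j₀} sup_{x_{j₀}} ∫ Π_{j ≠ j₀} dx_j |f(x₁,…,x₄)|`
(`∫ dx` includes the spin sum; `ℝ≥0∞`-valued). [cite: FeldmanKnorrerTrubowitz2004, §I p.4 (L66–74)] -/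
def l1linfNorm (f : Kernel) : ℝ≥0∞ :=
  ⨆ (j₀ : Fin 4) (y : SpaceTimeSpin),
    ∑ s : Fin 3 → Fin 2, ∫⁻ x : Fin 3 → SpaceTime, ‖f (Fin.insertNth j₀ y fun j => (x j, s j))‖ₑ

/-- **The norm on interaction kernels** of Theorem I:
`max ⫼ Π_{i<j} (δ_{ij}!)⁻¹ (x_i - x_j)^{δ_{ij}} V ⫼_{1,∞}` over multi-indices `δ_{ij}`, `1 ≤ i < j ≤ 4`, with
`Σ |δ⃗_{ij}| ≤ r` and `Σ δ_{ij,0} ≤ r₀` (`r, r₀ ≥ 6` the numbers of controlled spatial / temporal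
derivatives, p.4 L85). [cite: FeldmanKnorrerTrubowitz2004, §I p.4 (L85–97) and Thm I p.6 (L57–62)] -/
def kernelNorm (r r₀ : ℕ) (V : Kernel) : ℝ≥0∞ :=
  ⨆ (δ : LegPair → MultiIndex) (_ : ∑ p, (δ p).spatialLength ≤ r ∧ ∑ p, (δ p).1 ≤ r₀),
    l1linfNorm fun x => (∏ p : LegPair, ((δ p).factorial : ℝ)⁻¹ * monomial (δ p) (x p.1.1) (x p.1.2)) * V x

/-- The class of kernels of Theorem I: translation invariant, spin independent, finite norm `< ρ`
(the open ball of radius `ρ`). [cite: FeldmanKnorrerTrubowitz2004, Thm I p.6 (L53–62)] -/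
def kernelBall (r r₀ : ℕ) (ρ : ℝ≥0∞) : Set Kernel :=
  {V | IsTranslationInvariant V ∧ IsSpinIndependent V ∧ kernelNorm r r₀ V < ρ}

/-! ### The Fermi curve: data, Definition (strong asymmetry), Hypotheses -/

/-- Outward unit normal direction of angle `α`: `ν(α) = (cos α, sin α)`. [cite: FeldmanKnorrerTrubowitz2004, §I Definition i) p.7 (L90–97)] -/
def outward (α : ℝ) : R2 := !₂[Real.cos α, Real.sin α]

/-- Oriented unit tangent of angle `α`: `t(α) = (-sin α, cos α)` (counter-clockwise orientation). [cite: FeldmanKnorrerTrubowitz2004, §I Definition i) p.7 (L90–97)] -/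
def tangent (α : ℝ) : R2 := !₂[-Real.sin α, Real.cos α]

/-- **Fermi-curve data** for a dispersion relation `e` on `ℝ²`: a `2π`-periodic parametrisation `γ`
of `F = {e = 0}` by the angle `α` of the outward normal (Gauss map), the local graphs
`φ α : ℝ → ℝ` of Definition i) — `s ↦ γ(α) + s t(α) - φ_α(s) ν(α)` parametrises `F` near `γ(α)`, inward
normal `-ν(α)` — and a radius `ρ` of the graph neighbourhoods. Only DATA; the properties are
`FermiCurveData.IsRegular` / `Hypotheses`. [cite: FeldmanKnorrerTrubowitz2004, §I Definition i) p.7 (L90–97)] -/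
structure FermiCurveData where
  /-- the dispersion relation, already shifted by the chemical potential -/
  e : R2 → ℝ
  /-- Gauss-map parametrisation of the Fermi curve by the outward-normal angle -/
  γ : ℝ → R2
  /-- the local graph functions `φ_{γ(α)}(s)` of Definition i) -/
  φ : ℝ → ℝ → ℝ
  /-- radius of the neighbourhoods on which the local graphs describe `F` -/
  ρ : ℝ

/-- The local parametrisation of Definition i) at `γ(α)`: `s ↦ γ(α) + s t(α) + y (-ν(α))` evaluated at
height `y`. [cite: FeldmanKnorrerTrubowitz2004, §I Definition i) p.7 (L93–96)] -/
def FermiCurveData.chart (D : FermiCurveData) (α s y : ℝ) : R2 :=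
  D.γ α + s • tangent α - y • outward α

/-- The ANTIPODE `a(γ(α)) = γ(α + π)`: the unique other point of `F` whose tangent line is parallel
(p.7 L84–87; in the Gauss-map parametrisation the antipode has the opposite normal). [cite: FeldmanKnorrerTrubowitz2004, §I p.7 (L84–87)] -/
def FermiCurveData.antipodeAngle (α : ℝ) : ℝ := α + π

/-- **Regularity of the Fermi-curve data** (the non-asymmetry part of `\hypNPdisprel` together with
the defining properties of Definition i)): `e ∈ C^{r+6}`; `γ` is `2π`-periodic, continuous, injective
modulo `2π`, with range EXACTLY `F = {e = 0}` (so `F` is a connected closed curve); at `γ(α)` the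
gradient of `e` is a positive multiple of `ν(α)` (so `∇e ≠ 0` on `F`, `ν(α)` IS the outward normal and
`t(α)` the oriented tangent); for `|s|, |y| < ρ`, `γ(α) + s t(α) - y ν(α) ∈ F ↔ y = φ_α(s)`, with
`φ_α` of class `C^{r+6}` on `(-ρ, ρ)`, `|φ_α(s)| < ρ` there, `φ_α(0) = φ_α'(0) = 0` (Remark i), p.7
L107–108); STRICT CONVEXITY WITH CURVATURE BOUNDED AWAY FROM ZERO: `φ_α''(0) ≥ κ₀ > 0` uniformly
(`φ_α''(0)` is the curvature at `γ(α)`, Remark i)). A PREDICATE. [cite: FeldmanKnorrerTrubowitz2004, §I Hypothesis (hypNPdisprel) p.7 (L80–88), p.8 (L1–5); Definition i) and Remark i) p.7 (L90–108)] -/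
structure FermiCurveData.IsRegular (r : ℕ) (D : FermiCurveData) : Prop where
  smooth_e : ContDiff ℝ (r + 6 : ℕ) D.e
  ρ_pos : 0 < D.ρ
  periodic : Function.Periodic D.γ (2 * π)
  continuous_γ : Continuous D.γ
  injective : ∀ α α' : ℝ, D.γ α = D.γ α' → ∃ m : ℤ, α' = α + 2 * π * m
  range_eq : Set.range D.γ = fermiCurve D.e
  gradient : ∀ α : ℝ, ∃ m : ℝ, 0 < m ∧ ∀ w : R2, fderiv ℝ D.e (D.γ α) w = m * inner ℝ (outward α) w
  localGraph : ∀ α s y : ℝ, |s| < D.ρ → |y| < D.ρ → (D.e (D.chart α s y) = 0 ↔ y = D.φ α s)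
  smooth_φ : ∀ α : ℝ, ContDiffOn ℝ (r + 6 : ℕ) (D.φ α) (Set.Ioo (-D.ρ) D.ρ)
  φ_small : ∀ α s : ℝ, |s| < D.ρ → |D.φ α s| < D.ρ
  φ_zero : ∀ α : ℝ, D.φ α 0 = 0
  φ_deriv_zero : ∀ α : ℝ, deriv (D.φ α) 0 = 0
  curvature : ∃ κ₀ : ℝ, 0 < κ₀ ∧ ∀ α : ℝ, κ₀ ≤ iteratedDeriv 2 (D.φ α) 0

/-- **Definition (strong asymmetry), ii)** (p.7 L98–104): `F` is strongly asymmetric if there is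
`n₀ ≤ r` such that for each `k⃗ ∈ F` there is `n ≤ n₀` with `φ_k⃗^{(n)}(0) ≠ φ_{a(k⃗)}^{(n)}(0)`; here
`k⃗ = γ(α)`, `a(k⃗) = γ(α + π)`. By Remark ii) (p.7 L111–112) a Fermi curve symmetric about a point
(e.g. the square-lattice Hubbard curve, `k⃗ ↦ -k⃗`) has `φ_k⃗ = φ_{a(k⃗)}` and is NOT strongly
asymmetric. A PREDICATE. [cite: FeldmanKnorrerTrubowitz2004, §I Definition ii) (defNPstrongasymm) p.7 (L98–104)] -/
def StronglyAsymmetric (r : ℕ) (φ : ℝ → ℝ → ℝ) : Prop :=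
  ∃ n₀ : ℕ, n₀ ≤ r ∧ ∀ α : ℝ, ∃ n : ℕ, n ≤ n₀ ∧
    iteratedDeriv n (φ α) 0 ≠ iteratedDeriv n (φ (FermiCurveData.antipodeAngle α)) 0

/-- **Hypothesis on the dispersion relation** (`\hypNPdisprel`, p.8 L1–5): «`e(k⃗)` is `r + 6` times
continuously differentiable with `r ≥ 6`, the Fermi curve `F` is a strictly convex, smooth, strongly
asymmetric, connected curve whose curvature is bounded away from zero and `∇e(k⃗)` does not vanish on
`F`.» A PREDICATE on Fermi-curve data; never instantiated here. [cite: FeldmanKnorrerTrubowitz2004, §I Hypothesis (hypNPdisprel) p.7 (L80–88) and p.8 (L1–5)] -/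
structure Hypotheses (r : ℕ) (D : FermiCurveData) : Prop where
  six_le : 6 ≤ r
  regular : D.IsRegular r
  asymmetric : StronglyAsymmetric r D.φ

/-! ### Theorems I–III: the conclusions, over Green's-function data (gap G-t3-02) -/

/-- **Data of the renormalized expansion** (the objects of Theorem I, NOT constructed here — gap
G-t3-02): for each infrared cutoff scale `𝔦 ≥ 1` (real) and `n ≥ 1`, the scale-`𝔦` renormalized
connected Green's functions `G_{2n;𝔦}(V)(x₁,y₁,…,xₙ,yₙ)` (p.6 L1–15), their `𝔦 → ∞` limits `G_{2n}(V)`,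
and the counterterm map `V ↦ δe(V)`. [cite: FeldmanKnorrerTrubowitz2004, §I p.6 (L1–52) and Thm I p.6 (L53–84)] -/
structure RenormalizedGreenData where
  /-- `G 𝔦 n V pts = G_{2n;𝔦}(V)(pts)`, `pts : Fin (2n) → space–time–spin` -/
  G : ℝ → (n : ℕ) → Kernel → (Fin (2 * n) → SpaceTimeSpin) → ℂ
  /-- `Glim n V pts = G_{2n}(V)(pts)` -/
  Glim : (n : ℕ) → Kernel → (Fin (2 * n) → SpaceTimeSpin) → ℂ
  /-- the counterterm `δe(k⃗; V)` -/
  δe : Kernel → R2 → ℂ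

/-- **Theorem I (`\theoremNPmainthI`), conclusion** for a given ultraviolet cutoff `U` (which carries
`ℰ`), derivative orders `(r, r₀)` and
expansion data: there is a radius `ρ > 0` (an open ball about `0` in the kernel norm) such that
`δe(0) = 0`, `δe(V) ∈ ℰ` on the ball, `V ↦ δe(V)` and, for every real `𝔦 ≥ 1`, `V ↦ G_{2n;𝔦}(V)` are
analytic on the ball — rendered along complex lines: `z ↦ δe(zV)(k⃗)`, `z ↦ G_{2n;𝔦}(zV)(pts)` are
holomorphic on `{|z|·‖V‖ < ρ}` (for maps of one complex variable this is the convergence of the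
Taylor series at `0` with `𝔦`-independent radius); as `𝔦 → ∞`, `G_{2n;𝔦} → G_{2n}` UNIFORMLY in the
points and in `V` on the ball; `G_{2n}` is translation invariant and analytic in `V` (same
rendering); if `V` is `k₀`-reversal real then `δe(k⃗; V)` is real. (The printed «spin independent,
particle number conserving» of `G_{2n}` is recorded in prose only.) [cite: FeldmanKnorrerTrubowitz2004, Thm I (theoremNPmainthI) p.6 (L53–84)] -/
def TheoremIConclusion (U : R2 → ℝ) (r r₀ : ℕ) (X : RenormalizedGreenData) : Prop :=
  ∃ ρ : ℝ≥0∞, 0 < ρ ∧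
    (∀ k, X.δe 0 k = 0) ∧
    (∀ V ∈ kernelBall r r₀ ρ, IsCounterterm U (X.δe V)) ∧
    (∀ V ∈ kernelBall r r₀ ⊤, ∀ k : R2,
      DifferentiableOn ℂ (fun z : ℂ => X.δe (z • V) k) {z | (‖z‖₊ : ℝ≥0∞) * kernelNorm r r₀ V < ρ}) ∧
    (∀ 𝔦 : ℝ, 1 ≤ 𝔦 → ∀ n : ℕ, 1 ≤ n → ∀ V ∈ kernelBall r r₀ ⊤, ∀ pts : Fin (2 * n) → SpaceTimeSpin,
      DifferentiableOn ℂ (fun z : ℂ => X.G 𝔦 n (z • V) pts)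
        {z | (‖z‖₊ : ℝ≥0∞) * kernelNorm r r₀ V < ρ}) ∧
    (∀ n : ℕ, 1 ≤ n → ∀ ε : ℝ, 0 < ε → ∃ 𝔦₀ : ℝ, ∀ 𝔦 : ℝ, 𝔦₀ ≤ 𝔦 →
      ∀ V ∈ kernelBall r r₀ ρ, ∀ pts : Fin (2 * n) → SpaceTimeSpin,
        ‖X.G 𝔦 n V pts - X.Glim n V pts‖ < ε) ∧
    (∀ n : ℕ, 1 ≤ n → ∀ V ∈ kernelBall r r₀ ρ, ∀ (a : SpaceTime) (pts : Fin (2 * n) → SpaceTimeSpin),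
      X.Glim n V (fun i => translate a (pts i)) = X.Glim n V pts) ∧
    (∀ n : ℕ, 1 ≤ n → ∀ V ∈ kernelBall r r₀ ⊤, ∀ pts : Fin (2 * n) → SpaceTimeSpin,
      DifferentiableOn ℂ (fun z : ℂ => X.Glim n (z • V) pts)
        {z | (‖z‖₊ : ℝ≥0∞) * kernelNorm r r₀ V < ρ}) ∧
    (∀ V ∈ kernelBall r r₀ ρ, IsK0ReversalReal V → ∀ k : R2, (X.δe V k).im = 0)

/-- **Momentum-space Green's-function data** (the objects of Theorems II–III, NOT constructed here —
gap G-t3-02): the Fourier transform `Ǧ₂(k₀, k⃗) = ∫ dx₀ d²x e^{i(-k₀x₀ + k⃗·x⃗)} G₂((0,0,↑),(x₀,x⃗,↑))`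
(`=` the same with `↓`, p.6 L89–95) and `Ǧ₄;σ₁σ₂σ₃σ₄(k₁,k₂,k₃)` (p.7 L1–8). [cite: FeldmanKnorrerTrubowitz2004, Thm II p.6 (L89–95) and Thm III p.7 (L1–8)] -/
structure MomentumGreenData where
  /-- `Ǧ₂(k₀, k⃗)` -/
  G₂ : SpaceTime → ℂ
  /-- `Ǧ₄;σ(k₁, k₂, k₃)`, `σ : Fin 4 → Fin 2` the four spins -/
  G₄ : (Fin 4 → Fin 2) → SpaceTime → SpaceTime → SpaceTime → ℂ

/-- The truncated `k₀`-integral `∫_{-R}^{R} dk₀/(2π) e^{ik₀τ} Ǧ₂(k₀, k⃗)` defining the momentum distribution. [cite: FeldmanKnorrerTrubowitz2004, Thm II p.6 (L98–101)] -/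
def momentumDistributionApprox (G₂ : SpaceTime → ℂ) (τ : ℝ) (k : R2) (R : ℝ) : ℂ :=
  ∫ k₀ in (-R)..R, ((2 * π)⁻¹ : ℝ) * Complex.exp (Complex.I * ((k₀ * τ : ℝ) : ℂ)) * G₂ (k₀, k)

/-- **Theorem II (`\theoremNPmainthII`), conclusion**: `Ǧ₂` is continuous except on the Fermi surface
`{k₀ = 0, e(k⃗) = 0}`; the momentum distribution
`n(k⃗) = lim_{τ→0+} ∫ dk₀/(2π) e^{ik₀τ} Ǧ₂(k₀,k⃗)` (the `k₀`-integral as an improper limit) exists, is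
continuous except on `F`, and at every `k̄ ∈ F` the limits of `n` from `{e > 0}` and from `{e < 0}`
exist with `lim_{e<0} n - lim_{e>0} n > ½` (the `½` «may be replaced by any number strictly smaller
than one, provided the interaction is made sufficiently weak», Remark p.6 L118–124 — typed as
printed, `> ½`). [cite: FeldmanKnorrerTrubowitz2004, Thm II (theoremNPmainthII) p.6 (L89–115)] -/
def TheoremIIConclusion (e : R2 → ℝ) (X : MomentumGreenData) : Prop :=
  ContinuousOn X.G₂ {k | ¬(k.1 = 0 ∧ e k.2 = 0)} ∧
  ∃ I : ℝ → R2 → ℂ,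
    (∀ τ : ℝ, 0 < τ → ∀ k : R2,
      Tendsto (momentumDistributionApprox X.G₂ τ k) atTop (𝓝 (I τ k))) ∧
    ∃ nk : R2 → ℝ,
      (∀ k : R2, Tendsto (fun τ => I τ k) (𝓝[>] 0) (𝓝 ((nk k : ℝ) : ℂ))) ∧
      ContinuousOn nk {k | e k ≠ 0} ∧
      ∀ kb ∈ fermiCurve e, ∃ nout nin : ℝ,
        Tendsto nk (𝓝[{k | 0 < e k}] kb) (𝓝 nout) ∧ Tendsto nk (𝓝[{k | e k < 0}] kb) (𝓝 nin) ∧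
        1 / 2 < nin - nout

/-- The amputation of `Ǧ₄` by the physical propagator:
`Ǧ₄^A(k₁,k₂,k₃) = Ǧ₄(k₁,k₂,k₃) Π_{ℓ=1}^4 Ǧ₂(k_ℓ)⁻¹`, `k₄ = k₁ - k₂ + k₃`. [cite: FeldmanKnorrerTrubowitz2004, Thm III p.7 (L9–13)] -/
def amputatedG₄ (X : MomentumGreenData) (σ : Fin 4 → Fin 2) (k₁ k₂ k₃ : SpaceTime) : ℂ :=
  X.G₄ σ k₁ k₂ k₃ * ((X.G₂ k₁)⁻¹ * (X.G₂ k₂)⁻¹ * (X.G₂ k₃)⁻¹ * (X.G₂ (k₁ - k₂ + k₃))⁻¹)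

/-- **Theorem III (`\theoremNPmainthIII`), conclusion**: `Ǧ₄^A` is continuous on
`{(k₁,k₂,k₃) : k₁ ≠ k₂, k₂ ≠ k₃, U(k⃗₁) = U(k⃗₂) = U(k⃗₃) = U(k⃗₁-k⃗₂+k⃗₃) = 1}` and decomposes there as
`N(k₁,k₂,k₃) + ½ L((k₁+k₂)/2, (k₃+k₄)/2, k₂-k₁) - ½ L((k₃+k₂)/2, (k₁+k₄)/2, k₂-k₃)`, `k₄ = k₁-k₂+k₃`,
with `N` continuous, `L(q₁,q₂,t)` continuous except at transfer `t = 0`, `L(q₁,q₂,(0,τ⃗))` having an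
extension to `τ⃗ = 0` continuous in `(q₁,q₂,τ⃗)`, and `L(q₁,q₂,(t₀,0⃗))` having an extension to `t₀ = 0`
continuous in `(q₁,q₂,t₀)` — TWO one-sided extensions (`L` = particle–hole ladders, Remark p.7
L44–49). [cite: FeldmanKnorrerTrubowitz2004, Thm III (theoremNPmainthIII) p.7 (L1–42)] -/
def TheoremIIIConclusion (U : R2 → ℝ) (X : MomentumGreenData) : Prop :=
  let dom : Set (SpaceTime × SpaceTime × SpaceTime) :=
    {k | k.1 ≠ k.2.1 ∧ k.2.1 ≠ k.2.2 ∧ U k.1.2 = 1 ∧ U k.2.1.2 = 1 ∧ U k.2.2.2 = 1 ∧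
      U (k.1 - k.2.1 + k.2.2).2 = 1}
  (∀ σ, ContinuousOn (fun k : SpaceTime × SpaceTime × SpaceTime => amputatedG₄ X σ k.1 k.2.1 k.2.2) dom) ∧
  ∃ N L : (Fin 4 → Fin 2) → SpaceTime → SpaceTime → SpaceTime → ℂ,
    (∀ σ, ∀ k ∈ dom,
      amputatedG₄ X σ k.1 k.2.1 k.2.2 =
        N σ k.1 k.2.1 k.2.2 +
          (1 / 2 : ℂ) * L σ ((1 / 2 : ℝ) • (k.1 + k.2.1)) ((1 / 2 : ℝ) • (k.2.2 + (k.1 - k.2.1 + k.2.2)))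
            (k.2.1 - k.1) -
          (1 / 2 : ℂ) * L σ ((1 / 2 : ℝ) • (k.2.2 + k.2.1)) ((1 / 2 : ℝ) • (k.1 + (k.1 - k.2.1 + k.2.2)))
            (k.2.1 - k.2.2)) ∧
    (∀ σ, Continuous fun k : SpaceTime × SpaceTime × SpaceTime => N σ k.1 k.2.1 k.2.2) ∧
    (∀ σ, ContinuousOn (fun k : SpaceTime × SpaceTime × SpaceTime => L σ k.1 k.2.1 k.2.2)
      {k | k.2.2 ≠ 0}) ∧
    (∀ σ, ∃ Lsp : SpaceTime → SpaceTime → R2 → ℂ,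
      Continuous (fun q : SpaceTime × SpaceTime × R2 => Lsp q.1 q.2.1 q.2.2) ∧
      ∀ q₁ q₂ : SpaceTime, ∀ τ : R2, τ ≠ 0 → Lsp q₁ q₂ τ = L σ q₁ q₂ (0, τ)) ∧
    (∀ σ, ∃ Ltm : SpaceTime → SpaceTime → ℝ → ℂ,
      Continuous (fun q : SpaceTime × SpaceTime × ℝ => Ltm q.1 q.2.1 q.2.2) ∧
      ∀ q₁ q₂ : SpaceTime, ∀ t₀ : ℝ, t₀ ≠ 0 → Ltm q₁ q₂ t₀ = L σ q₁ q₂ (t₀, 0))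

end FKT2004

end Literature.MathematicalPhysics.QuantumLattice.FermiRG


/-! ### Remark ii) (p.7 L111–115): point symmetry kills strong asymmetry — PROVED -/

namespace Literature.MathematicalPhysics.QuantumLattice.FermiRG

namespace FKT2004

open Real

/-- `t(α + π) = -t(α)`. [folklore] -/
private theorem tangent_add_pi (α : ℝ) : tangent (α + π) = -tangent α := by
  ext i
  fin_cases i <;> simp [tangent, Real.sin_add_pi, Real.cos_add_pi]

/-- `ν(α + π) = -ν(α)`. [folklore] -/
private theorem outward_add_pi (α : ℝ) : outward (α + π) = -outward α := by
  ext i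
  fin_cases i <;> simp [outward, Real.sin_add_pi, Real.cos_add_pi]

/-- Under point symmetry of the parametrisation, the chart at the antipode is the reflected chart:
`γ(α+π) + s t(α+π) - y ν(α+π) = 2p - (γ(α) + s t(α) - y ν(α))`. [folklore] -/
private theorem chart_add_pi (D : FermiCurveData) (p : R2) (hsym : ∀ α, D.γ (α + π) = (2 : ℝ) • p - D.γ α)
    (α s y : ℝ) : D.chart (α + π) s y = (2 : ℝ) • p - D.chart α s y := by
  simp only [FermiCurveData.chart, hsym, tangent_add_pi, outward_add_pi, smul_neg]
  abel

/-- **FKT Remark ii) (p.7 L111–112), proved:** if the Fermi curve is symmetric about a point `p` —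
for a strictly convex curve in the Gauss-map parametrisation this reads `γ(α + π) = 2p - γ(α)` (the
antipode is the reflected point) — then `φ_k⃗ = φ_{a(k⃗)}` near `0` for every `k⃗ ∈ F`, hence `F` is NOT
strongly asymmetric (for any `r`). This is why a point-symmetric Fermi curve (e.g. the square-lattice
Hubbard curve, `k⃗ ↦ -k⃗`) is outside the hypotheses of Theorems I–III: «Symmetry of the Fermi curve
about a point promotes the formation of Cooper pairs». [cite: FeldmanKnorrerTrubowitz2004, §I Remark ii) (remModII) p.7 (L111–115)] -/
theorem not_stronglyAsymmetric_of_pointSymmetric {r : ℕ} {D : FermiCurveData} (hD : D.IsRegular r)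
    (p : R2) (hsym : ∀ α : ℝ, D.γ (α + π) = (2 : ℝ) • p - D.γ α) (r' : ℕ) :
    ¬ StronglyAsymmetric r' D.φ := by
  -- Step 1: `F = 2p - F` as a set.
  have hF : ∀ k : R2, D.e k = 0 → D.e ((2 : ℝ) • p - k) = 0 := by
    intro k hk
    have hkF : k ∈ fermiCurve D.e := hk
    rw [← hD.range_eq] at hkF
    obtain ⟨β, rfl⟩ := hkF
    have : D.γ (β + π) ∈ fermiCurve D.e := by rw [← hD.range_eq]; exact ⟨β + π, rfl⟩
    rw [hsym β] at this
    exact this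
  -- Step 2: the local graphs at `α` and at the antipode agree on `(-ρ, ρ)`.
  have hφ : ∀ α s : ℝ, |s| < D.ρ → D.φ (α + π) s = D.φ α s := by
    intro α s hs
    have hy : |D.φ α s| < D.ρ := hD.φ_small α s hs
    have h1 : D.e (D.chart α s (D.φ α s)) = 0 := (hD.localGraph α s (D.φ α s) hs hy).2 rfl
    have h2 : D.e (D.chart (α + π) s (D.φ α s)) = 0 := by
      rw [chart_add_pi D p hsym]; exact hF _ h1
    exact ((hD.localGraph (α + π) s (D.φ α s) hs hy).1 h2).symm
  -- Step 3: hence all derivatives at `0` agree, contradicting strong asymmetry.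
  have hev : ∀ α : ℝ, D.φ (α + π) =ᶠ[nhds 0] D.φ α := by
    intro α
    have hmem : Set.Ioo (-D.ρ) D.ρ ∈ nhds (0 : ℝ) := Ioo_mem_nhds (by linarith [hD.ρ_pos]) hD.ρ_pos
    filter_upwards [hmem] with s hs
    exact hφ α s (abs_lt.2 ⟨hs.1, hs.2⟩)
  rintro ⟨n₀, -, hA⟩
  obtain ⟨n, -, hne⟩ := hA 0
  apply hne
  rw [FermiCurveData.antipodeAngle, (hev 0).iteratedDeriv_eq n]

end FKT2004

end Literature.MathematicalPhysics.QuantumLattice.FermiRG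

end
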